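import Summits.PneNP.PneNP.Theorems.KarlinRubinMonotoneBlindDnfPlanted

/-!
# Crux `MonotoneBlind` (stmt-PneNP-18027, route KarlinRubin), line `Sketch` (vertex-cover duality) — the stub `stub_coverBound`

**Cover bound** (registered stub of `Summits/PneNP/PneNP/Cruxes/MonotoneBlind/Lines/Sketch.lean`). Under the
uniform law on `kSubsets n k` (the `d`-subsets of `Fin n`, `d = min k n`), a family `G` of vertex sets COVERING a
family `U` (every `A ∈ U` contains some `S ∈ G`) certifies `μ_k(U) ≤ Σ_{S ∈ G} (d/n)^{|S|}`:

* union bound over `S ∈ G` on the count `#{A ∈ kSubsets | A ∈ U}` (`PMF.toOuterMeasure_uniformOfFinset_apply`,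
  `Finset.card_biUnion_le`);
* the fibre factor `Pr_A[S ⊆ A] ≤ (d/n)^{|S|}`, i.e. `#{A ∈ kSubsets | S ⊆ A} · n^{|S|} ≤ #kSubsets · d^{|S|}`
  (`Summit.PneNP.PneNP.Theorems.card_kSubsets_filter_superset_mul_le`); the degenerate case `n = 0` (only `S = ∅`,
  term `1`) is `#filter ≤ #kSubsets`.

`--supports stmt-PneNP-18027`; no definitions.
-/

set_option linter.dupNamespace false -- `Summit.PneNP.PneNP.…` is the layout-mandated namespace (D-0017)

namespace Summit.PneNP.PneNP.Theorems.MonotoneBlind.VertexCover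

open Literature.Computability.Complexity Literature.Probability.RandomGraphs.PlantedClique Filter Finset
open scoped ENNReal Topology Classical

/-- `(a / b)^m = a^m / b^m` in `ℝ≥0∞` (no `DivisionMonoid` structure, but `(b^m)⁻¹ = (b⁻¹)^m` holds). [folklore] -/
theorem div_pow_eq_pow_div (a b : ℝ≥0∞) (m : ℕ) : (a / b) ^ m = a ^ m / b ^ m := by
  rw [div_eq_mul_inv, mul_pow, ← ENNReal.inv_pow, ← div_eq_mul_inv]

/-- **Fibre factor.** `Pr_A[S ⊆ A] ≤ (d/n)^{|S|}` under the uniform law on `kSubsets n k` (`d = min k n`), as a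
count ratio in `ℝ≥0∞`: from `#{A ∈ kSubsets | S ⊆ A} · n^{|S|} ≤ #kSubsets · d^{|S|}` for `0 < n`, and from
`#filter ≤ #kSubsets` for `n = 0` (then `S = ∅`). [folklore] -/
theorem card_filter_superset_div_le (n k : ℕ) (S : Finset (Fin n)) :
    ((#((kSubsets n k).filter fun A => S ⊆ A) : ℕ) : ℝ≥0∞) / ((#(kSubsets n k) : ℕ) : ℝ≥0∞) ≤
      (((min k n : ℕ) : ℝ≥0∞) / (n : ℝ≥0∞)) ^ #S := by
  rcases Nat.eq_zero_or_pos n with rfl | hn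
  · -- `Fin 0` is empty: `S = ∅` and the right-hand side is `1`
    have hS : S = ∅ := S.eq_empty_of_isEmpty
    subst hS
    rw [card_empty, pow_zero]
    exact ENNReal.div_le_of_le_mul (by rw [one_mul]; exact_mod_cast card_filter_le _ _)
  · have hcount := Summit.PneNP.PneNP.Theorems.card_kSubsets_filter_superset_mul_le S k
    have key : ((#((kSubsets n k).filter fun A => S ⊆ A) : ℕ) : ℝ≥0∞) * (n : ℝ≥0∞) ^ #S ≤
        ((#(kSubsets n k) : ℕ) : ℝ≥0∞) * ((min k n : ℕ) : ℝ≥0∞) ^ #S := by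
      exact_mod_cast hcount
    have hn0 : (n : ℝ≥0∞) ^ #S ≠ 0 := pow_ne_zero _ (by exact_mod_cast hn.ne')
    have hntop : (n : ℝ≥0∞) ^ #S ≠ ⊤ := ENNReal.pow_ne_top (ENNReal.natCast_ne_top n)
    rw [div_pow_eq_pow_div, ENNReal.le_div_iff_mul_le (Or.inl hn0) (Or.inl hntop), div_eq_mul_inv,
      mul_right_comm, ← div_eq_mul_inv]
    exact ENNReal.div_le_of_le_mul' key

/-- **stub_coverBound** (registered stub of line `Sketch`, crux stmt-PneNP-18027; size S). For every `n k`,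
every family `U` of vertex sets and every `G` covering `U` (each `A ∈ U` contains some `S ∈ G`): the
uniform-`kSubsets n k` measure of `U` is at most `Σ_{S ∈ G} (d/n)^{|S|}`, `d = min k n`. Proof:
`{A ∈ kSubsets | A ∈ U} ⊆ ⋃_{S ∈ G} {A ∈ kSubsets | S ⊆ A}` (union bound, `PMF.toOuterMeasure_uniformOfFinset_apply`,
`Finset.card_biUnion_le`), then the fibre factor `card_filter_superset_div_le` termwise. [folklore] -/
theorem stub_coverBound :
    ∀ (n k : ℕ) (U : Set (Finset (Fin n))) (G : Finset (Finset (Fin n))),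
      (∀ A ∈ U, ∃ S ∈ G, S ⊆ A) →
        (PMF.uniformOfFinset (kSubsets n k) (kSubsets_nonempty n k)).toOuterMeasure U ≤
          ∑ S ∈ G, ((((min k n : ℕ) : ℝ≥0∞) / (n : ℝ≥0∞)) ^ S.card) := by
  intro n k U G hcov
  rw [PMF.toOuterMeasure_uniformOfFinset_apply]
  -- union bound on the count
  have hsub : ((kSubsets n k).filter fun A => A ∈ U) ⊆ G.biUnion fun S => (kSubsets n k).filter fun A => S ⊆ A := by
    intro A hA
    rw [mem_filter] at hA
    obtain ⟨S, hS, hSA⟩ := hcov A hA.2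
    exact mem_biUnion.2 ⟨S, hS, mem_filter.2 ⟨hA.1, hSA⟩⟩
  have hcard : #((kSubsets n k).filter fun A => A ∈ U) ≤ ∑ S ∈ G, #((kSubsets n k).filter fun A => S ⊆ A) :=
    (card_le_card hsub).trans card_biUnion_le
  calc ((#((kSubsets n k).filter fun A => A ∈ U) : ℕ) : ℝ≥0∞) / ((#(kSubsets n k) : ℕ) : ℝ≥0∞)
      ≤ ((∑ S ∈ G, #((kSubsets n k).filter fun A => S ⊆ A) : ℕ) : ℝ≥0∞) / ((#(kSubsets n k) : ℕ) : ℝ≥0∞) :=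
        ENNReal.div_le_div_right (by exact_mod_cast hcard) _
    _ = ∑ S ∈ G, ((#((kSubsets n k).filter fun A => S ⊆ A) : ℕ) : ℝ≥0∞) / ((#(kSubsets n k) : ℕ) : ℝ≥0∞) := by
        rw [Nat.cast_sum]
        simp only [div_eq_mul_inv, sum_mul]
    _ ≤ ∑ S ∈ G, (((min k n : ℕ) : ℝ≥0∞) / (n : ℝ≥0∞)) ^ #S :=
        sum_le_sum fun S _ => card_filter_superset_div_le n k S

end Summit.PneNP.PneNP.Theorems.MonotoneBlind.VertexCover
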